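import Summits.Ventures.HodgeRepro2.T6B3HypHost
import Summits.Ventures.HodgeRepro2.T6B4Main

/-!
# T6B3HostMain — THEOREM B3(ii)–(iii) over the host family `τ′ ↦ A_μ ⊗_{E,τ′} ℂ` (Tier 6, sub-goal B3; t6-p6)

Record formalised: route/TIER4.md §B3, THEOREM B3(ii) («for every embedding τ′ the inclusion-eigenline
ℓ_μ(τ′) ⊂ H¹(A_μ ⊗_{E,τ′} ℂ) is one-dimensional and lies in H^{1,0} iff τ′ ∈ Φ_μ») and (iii) (the F-type
of A_μ ⊗_{τ₁} ℂ), proofs §B3(b) (Eq), (d) (D) and (e′), over the lead's shared host datum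
`Host.CMVariety M` (ruling R8, STATUS l. 4854; T6Host v3 = the order form of STATUS 18:09:43Z (1)): the
conjugates A_μ ⊗_{E,τ′} ℂ are a FAMILY
`Aμ : (K →+* ℂ) → Host.CMVariety M` (M = the field of values M_μ of μ^alg, Liu Def. 4.5(2) with
t6-lit F14's symbols), its type function `typeFun M Aμ : τ′ ↦ (Aμ τ′).type` is the `Φt` of
T6B4Interface.lean, and:
* the first clause of (ii) is the datum's `finrank_eig` at the inclusion θ₀ = `algebraMap M ℂ`
  (`finrank_inclusionEigenline`, on the complexified rational H¹: `Host.eigC`);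
* the second clause of (ii) is `T6B4Interface.HodgeDictionary M Φμ (typeFun M Aμ)` read through
  `type_spec` (`inclusionEigenline_h10_iff`: every θ₀-eigenvector of the order action on H¹(A_μ ⊗_{τ′} ℂ, ℂ)
  is of the host's Hodge type (1,0) iff τ′ ∈ Φ_μ — T6Host v3's reading of «ℓ_μ(τ′) ⊂ H^{1,0}»), and (iii) is
  t6-p7's `B4Main.B4_main` applied to the family
  (`B3_host_main`) — BOTH modulo the two interface Props (Eq) = `EqCompat` and (D) = `HodgeDictionary`,
  which are INTERFACE RESIDUALS of B3 at M1 (class IR): TIER4 §B3(b) proves (Eq) through the conjugate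
  variety A_μ ⊗_{E,g∘τ′} ℂ = (A_μ ⊗_{E,τ′} ℂ) ⊗_{ℂ,g} ℂ (Lange Prop. 1.1.9) and §B3(d) proves (D)
  through Shimura's Hecke character of (A_μ, i_μ) (Shimura 1998 Thm. 19.8 / Prop. 19.10 / (19.10a)),
  and neither the g-conjugate of a host abelian variety nor a Hecke character has a host or kernel
  carrier, so no faithful display derives them (route/T6-B3-t6-p6.md v0.6 §13).
No new definition beyond `typeFun`; no display (the file's only display input, Shimura 1998 §6.1
COROLLARY, lives in T6B3HypHost.lean and is consumed by B4's isogeny step, not here). §8(d): uses an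
L-value-free non-vanishing device: NO.
-/

namespace Summit.Ventures.HodgeRepro2.T6.B3Host

open Summit.Ventures.HodgeRepro2 Summit.Ventures.HodgeRepro2.T6.B4Interface
open HostAPI.Carriers.AlgebraicGeometry.HodgeTheory

variable {K : Type*} [Field K]

/-- The type function `τ′ ↦ Φ̃(τ′)` of a family of host CM varieties indexed by the embeddings of `K`:
the CM type of `A_μ ⊗_{E,τ′} ℂ` (TIER4 §B4.0), the carrier `Φt` of T6B4Interface's (Eq) / (D). -/
def typeFun (M : Type) [Field M] [NumberField M] [NumberField.IsCMField M]
    (Aμ : (K →+* ℂ) → Host.CMVariety M) : (K →+* ℂ) → Set (M →+* ℂ) :=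
  fun τ' => (Aμ τ').type

/-- THEOREM B3(ii), first clause: the inclusion-eigenline `ℓ_μ(τ′) ⊂ ℂ ⊗ H¹(A_μ ⊗_{E,τ′} ℂ, ℚ)` — the
`θ₀`-eigenspace of the complexified `M`-action for the inclusion `θ₀ = algebraMap M ℂ` — is
one-dimensional (Liu p. 52 ll. 65–67 «It is clear that the maximal subspace … has dimension 1»; here the
datum's `finrank_eig`). -/
theorem finrank_inclusionEigenline (M : IntermediateField ℚ ℂ) [NumberField M]
    [NumberField.IsCMField M] (Aμ : (K →+* ℂ) → Host.CMVariety M) (τ' : K →+* ℂ) :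
    Module.finrank ℂ (Host.eigC (Aμ τ').act (algebraMap M ℂ)) = 1 :=
  (Aμ τ').finrank_eig _

/-- THEOREM B3(ii), second clause, modulo (D): `ℓ_μ(τ′) ⊂ H^{1,0}(A_μ ⊗_{E,τ′} ℂ)` iff `τ′ ∈ Φ_μ` — in
T6Host v3's words, every `θ₀`-eigenvector of the order action on `H¹(A_μ ⊗_{E,τ′} ℂ, ℂ)` is of the host's
Hodge type `(1,0)` iff `τ′ ∈ Φ_μ`: the datum's `type_spec` at `θ₀` composed with `HodgeDictionary`
(«θ₀ ∈ Φ̃(τ′) iff τ′ ∈ Φ_μ»). -/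
theorem inclusionEigenline_h10_iff (M : IntermediateField ℚ ℂ) [NumberField M]
    [NumberField.IsCMField M] (Φμ : Set (K →+* ℂ)) (Aμ : (K →+* ℂ) → Host.CMVariety M)
    (hD : HodgeDictionary M Φμ (typeFun M Aμ)) (τ' : K →+* ℂ) :
    (∀ c : Host.H (Aμ τ').A.X 1,
      (∀ x : (Aμ τ').O', Host.avPull ((Aμ τ').endo x) 1 c = algebraMap M ℂ x • c) →
        IsOfHodgeType (Aμ τ').A.dim (Aμ τ').A.X 1 1 0 c) ↔ τ' ∈ Φμ :=
  ((Aμ τ').type_spec (algebraMap M ℂ)).symm.trans (hD τ')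

/-- THEOREM B3(ii) + (iii) over the host family, modulo the interface residuals (Eq) and (D): for every
`τ′`, `ℓ_μ(τ′)` is a line, of type `(1,0)` iff `τ′ ∈ Φ_μ`; and the `F`-type of `A_μ ⊗_{τ₁} ℂ` (with `F`
acting through `F₁ = τ₁(F) ⊆ M`, `hτ`) is the type induced from `(F₁, Φ_μ⁻¹)` — t6-p7's `B4_main`
(TIER4 Lemma B4.4 / CLAIM (B4-I)) applied to `typeFun M Aμ`. -/
theorem B3_host_main [NumberField K] [IsGalois ℚ K] (τ₁ : K →+* ℂ) (Φμ : Set (K →+* ℂ))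
    (M : IntermediateField ℚ ℂ) [FiniteDimensional ℚ M] [NumberField M] [NumberField.IsCMField M]
    [Algebra K M] (hτ : (algebraMap M ℂ).comp (algebraMap K M) = τ₁)
    (Aμ : (K →+* ℂ) → Host.CMVariety M)
    (hEq : EqCompat M (typeFun M Aμ)) (hD : HodgeDictionary M Φμ (typeFun M Aμ)) :
    (∀ τ' : K →+* ℂ, Module.finrank ℂ (Host.eigC (Aμ τ').act (algebraMap M ℂ)) = 1) ∧
    (∀ τ' : K →+* ℂ,
      (∀ c : Host.H (Aμ τ').A.X 1,
        (∀ x : (Aμ τ').O', Host.avPull ((Aμ τ').endo x) 1 c = algebraMap M ℂ x • c) →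
          IsOfHodgeType (Aμ τ').A.dim (Aμ τ').A.X 1 1 0 c) ↔ τ' ∈ Φμ) ∧
    InverseTypeForced τ₁ Φμ M (typeFun M Aμ) :=
  ⟨finrank_inclusionEigenline M Aμ, inclusionEigenline_h10_iff M Φμ Aμ hD,
    B4Main.B4_main τ₁ Φμ M hτ (typeFun M Aμ) hEq hD⟩

/-- THEOREM B3(ii) + (iii) AT THE FOUR VERTICES OF A FACE, modulo (Eq) and (D) at each vertex: with
`Φ_{μ_i} = T_i⁻¹` (the output `cmTypeOfImaginary K (D.vertex i).e = inverseType K τ₁ (T i)` of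
`B3_triples`, supplied as `hΦ`), for every vertex `i` the inclusion-eigenline of `A_{μ_i} ⊗_{τ′} ℂ` is
of type `(1,0)` iff `τ′ ∈ T_i⁻¹`, and the `F`-type of `A_{μ_i} ⊗_{τ₁} ℂ` is INDUCED FROM `T_i` —
`Φ̃_i(τ₁) = {θ : θ|_{F₁} ∘ τ₁ ∈ T_i}`, «r_i · T_i» with `r_i = [M_{μ_i} : F₁]` (TIER4 §B3(e′); t6-p7's
`B4_vertex`, which inverts the inverse type). One field `M i` (the field of values of `μ_i^alg`) and
one host family per vertex. -/
theorem B3_host_face [NumberField K] [IsGalois ℚ K] (τ₁ : K →+* ℂ) (T : Fin 4 → Set (K →+* ℂ))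
    (Φμ : Fin 4 → Set (K →+* ℂ)) (hΦ : ∀ i, Φμ i = inverseType K τ₁ (T i))
    (M : Fin 4 → IntermediateField ℚ ℂ) [∀ i, FiniteDimensional ℚ (M i)] [∀ i, NumberField (M i)]
    [∀ i, NumberField.IsCMField (M i)] [∀ i, Algebra K (M i)]
    (hτ : ∀ i, (algebraMap (M i) ℂ).comp (algebraMap K (M i)) = τ₁)
    (Aμ : ∀ i, (K →+* ℂ) → Host.CMVariety (M i))
    (hEq : ∀ i, EqCompat (M i) (typeFun (M i) (Aμ i)))
    (hD : ∀ i, HodgeDictionary (M i) (Φμ i) (typeFun (M i) (Aμ i))) :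
    ∀ i, (∀ τ' : K →+* ℂ,
        (∀ c : Host.H (Aμ i τ').A.X 1,
          (∀ x : (Aμ i τ').O', Host.avPull ((Aμ i τ').endo x) 1 c = algebraMap (M i) ℂ x • c) →
            IsOfHodgeType (Aμ i τ').A.dim (Aμ i τ').A.X 1 1 0 c) ↔
          τ' ∈ inverseType K τ₁ (T i)) ∧
      typeFun (M i) (Aμ i) τ₁ = inducedSet (T i) := by
  intro i
  have hD' : HodgeDictionary (M i) (inverseType K τ₁ (T i)) (typeFun (M i) (Aμ i)) := by
    rw [← hΦ i]; exact hD i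
  exact ⟨fun τ' => ((Aμ i τ').type_spec (algebraMap (M i) ℂ)).symm.trans (hD' τ'),
    B4Main.B4_vertex τ₁ (T i) (M i) (hτ i) (typeFun (M i) (Aμ i)) (hEq i) hD'⟩

end Summit.Ventures.HodgeRepro2.T6.B3Host
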